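import Summits.NavierStokesRegularity.NavierStokesRegularity.Theorems.StrainDoorsDoorX2Closed
import Literature.Analysis.FluidPDE.BarkerPrangeConcentrationHolds
import Literature.Analysis.FluidPDE.NSSereginEnergyApproximants
import HarnessLib

/-!
# Strain doors, PART M §M31(f) — DOOR X CLOSED: `sliceL3Concentration_holds`, and the `M`-only fixed-`δ₀` criterion

ROUND 70 of the `ns-regularity-ideate` programme (p1 line; helper lane of `stmt-NavierStokesRegularity-0056`, rung N0;
nothing here is a claim about Navier–Stokes regularity).  THIS FILE (imports N11d `StrainDoorsDoorX2Closed` — hence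
ROUND 68's N8/N9 and ROUND 69's N10 — and the tree's Barker–Prange concentration files):
* `l3_concentration_of_cappedMorreyTypeI_local` — the CAPPED local form of Barker–Prange 2020 Theorem 2 (Morrey-type
  bound only at radii `r²/ν < T`; conclusion for `T − t < S T`); proof = ROUND 68 §M27(b) verbatim (the Morrey bound is
  used at the single radius `√(ν(T−t)/S)`);
* ★★★★ `sliceL3Concentration_holds : SliceL3Concentration` — DOOR X of ROUND 68 §M26(a) CLOSED: `M`-only every-time
  `L³` concentration at sup-norm Type-I singular points (door X″ `ulocMorreyBoundSupTypeI_holds` ∘ the capped Theorem 2);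
* ★★★★ `sliceAligned_fixedDelta_not_singular_of_supTypeI_M_only` — ROUND 68's conditional criterion §M26(f) made
  unconditional: Barker–Prange's Theorem 3 with ONE fixed `δ₀ = δ₀(M,R)` along ONE sequence of times, for classical
  Leray–Hopf solutions Type I in the sup-norm; `δ₀` depends on `M` and `R` alone.
No `sorry`, no new axioms, no instances, no notation, no definitions.
-/

noncomputable section

set_option linter.dupNamespace false

open MeasureTheory Set Function Filter Metric Real
open _root_.Topology
open scoped ENNReal NNReal RealInnerProductSpace
open Literature.Analysis Literature.Analysis.FluidPDE

namespace Summit.NavierStokesRegularity.NavierStokesRegularity.Theorems.StrainDoors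

/-! ### §M31(f) Door X closed: `M`-only `L³` concentration and the `M`-only fixed-`δ₀` criterion -/

/-- **The CAPPED local form of Barker–Prange's Theorem 2** (cf. ROUND 68 §M27(b)
`l3_concentration_of_morreyTypeI_local`, which asks the Morrey-type bound at ALL radii): the Morrey-type
Type-I bound is assumed only at radii with `r²/ν < T` (parabolic window inside the lifespan), and the `L³`
concentration `‖u(t)‖_{L³(B̄(x₀, 2√(ν(T−t)/S)))} > γν` at a singular point `(T,x₀)` is concluded for the times
`t ∈ (0,T)` with `T − t < S·T`.  Proof = §M27(b) verbatim: the Morrey bound is used at the single radius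
`λ = √(ν(T−t)/S)`, and `λ²/ν = (T−t)/S < T` exactly when `T − t < S T`.
[cite: BarkerPrange2020, Thm 2 and its proof §4.2 (arXiv:1812.09115 pp. 4–5, 25–27)] -/
theorem l3_concentration_of_cappedMorreyTypeI_local :
    ∃ γ : ℝ, 0 < γ ∧ ∀ M : ℝ, 0 < M → ∃ S : ℝ, 0 < S ∧ S ≤ 1 / 4 ∧
      ∀ (ν T : ℝ), 0 < ν → 0 < T →
      ∀ (u₀ : EuclideanSpace ℝ (Fin 3) → EuclideanSpace ℝ (Fin 3))
        (u : ℝ → EuclideanSpace ℝ (Fin 3) → EuclideanSpace ℝ (Fin 3)), IsLerayHopfOn T ν 0 u₀ u →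
        (∀ (y : EuclideanSpace ℝ (Fin 3)) (r : ℝ), 0 < r → r ^ 2 / ν < T → ∀ t : ℝ, 0 < t →
            T - r ^ 2 / ν < t → t < T →
            eLpNorm (u t) 2 (volume.restrict (ball y r)) ≤ ENNReal.ofReal (M * ν * Real.sqrt r)) →
        (∀ t ∈ Ioo 0 T, ∀ x : EuclideanSpace ℝ (Fin 3), IsRegularPoint u (t, x)) →
        ∀ x₀ : EuclideanSpace ℝ (Fin 3),
          (∀ r : ℝ, 0 < r → r ^ 2 < T →
            eLpNorm (uncurry u) ⊤ (volume.restrict (parabolicCylinder r ((T : ℝ), x₀))) = ⊤) →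
          ∀ t ∈ Ioo 0 T, T - t < S * T → ENNReal.ofReal (γ * ν) <
            eLpNorm (u t) 3 (volume.restrict (closedBall x₀ (2 * Real.sqrt (ν * (T - t) / S)))) := by
  obtain ⟨γ, hγ, hT1⟩ := BarkerPrange2020_thm1_slab
  refine ⟨γ, hγ, fun M hM => ?_⟩
  obtain ⟨S, hS, hS4, hsm⟩ := hT1 M hM
  refine ⟨S, hS, hS4, fun ν T hν hT => ?_⟩
  have hS1 : S < 1 := by linarith
  intro u₀ u hLH hTypeI hReg x₀ hSing t ht hcap
  have ht0 : 0 < t := ht.1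
  have htT : t < T := ht.2
  have hTt : 0 < T - t := sub_pos.2 htT
  by_contra hcon
  rw [not_lt] at hcon
  -- the similarity scale `λ`, `λ² = ν (T - t) / S`
  have hpos : 0 < ν * (T - t) / S := div_pos (mul_pos hν hTt) hS
  obtain ⟨l, hl_def, hl, hl2⟩ :
      ∃ l : ℝ, l = Real.sqrt (ν * (T - t) / S) ∧ 0 < l ∧ l ^ 2 = ν * (T - t) / S :=
    ⟨_, rfl, Real.sqrt_pos.2 hpos, Real.sq_sqrt hpos.le⟩
  rw [← hl_def] at hcon
  have hν0 : ν ≠ 0 := hν.ne'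
  have hS0 : S ≠ 0 := hS.ne'
  have hl0 : l ≠ 0 := hl.ne'
  have hTt0 : T - t ≠ 0 := hTt.ne'
  have hβ : 0 < l ^ 2 / ν := by positivity
  have hl2ν : l ^ 2 / ν = (T - t) / S := by
    rw [hl2]; field_simp
  -- the time window of the Type-I bound at radius `λ`: `T - λ²/ν < t` since `S < 1`
  have hwin : T - l ^ 2 / ν < t := by
    rw [hl2ν]
    have h1 : (T - t) * S < T - t := mul_lt_of_lt_one_right hTt hS1
    have h2 : T - t < (T - t) / S := (lt_div_iff₀ hS).2 h1
    linarith
  -- the restarted solution, and the rescaled local energy solution of §4.2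
  obtain ⟨pr, hpr⟩ := hLH.exists_isLocalEnergySolutionOn_restart hν hT hReg ⟨ht0, htT⟩
  have hβeq : l ^ 2 / ν = l / ν * l := by
    rw [sq]; ring
  have hv := hpr.stRescale (div_pos hl hν) hl hβeq x₀
  have hslab : (T - t) / (l ^ 2 / ν) = S := by
    rw [hl2]; field_simp
  have hvisc : l / ν * ν / l = 1 := by
    field_simp
  have hfun : ((l / ν) • stPull (l ^ 2 / ν) l 0 x₀ fun s => u (t + s)) =
      (l / ν) • stPull (l ^ 2 / ν) l t x₀ u := by
    funext s y
    simp only [smul_stPull_apply, zero_add]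
  rw [hslab, hvisc, hfun] at hv
  -- its datum: in `L²`, hence in `E²`
  have hut : MemLp (u t) 2 volume := hLH.memLp t ⟨ht0.le, htT.le⟩
  have hv₀2 : MemLp (fun y => (l / ν) • u t (x₀ + l • y)) 2 volume :=
    (memLp_comp_add_smul hut x₀ hl).const_smul (l / ν)
  have hE2 : MemE2 (fun y => (l / ν) • u t (x₀ + l • y)) :=
    memE2_of_memLp hv₀2 le_rfl (by norm_num)
  have hsmul : ∀ q : ℝ≥0∞, ∀ μ : Measure (EuclideanSpace ℝ (Fin 3)),
      eLpNorm (fun y => (l / ν) • u t (x₀ + l • y)) q μ =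
        ‖l / ν‖ₑ * eLpNorm (fun y => u t (x₀ + l • y)) q μ := fun q μ => by
    rw [show (fun y => (l / ν) • u t (x₀ + l • y)) = (l / ν) • fun y => u t (x₀ + l • y)
      from rfl, eLpNorm_const_smul]
  have hlν : ‖l / ν‖ₑ = ENNReal.ofReal (l / ν) := Real.enorm_eq_ofReal (by positivity)
  -- `‖v₀‖_{L²(B₁(x̄))} ≤ M` from the Type-I bound at radius `λ`
  have hL2 : ∀ x₁ : (EuclideanSpace ℝ (Fin 3)), eLpNorm (fun y => (l / ν) • u t (x₀ + l • y)) 2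
      (volume.restrict (ball x₁ 1)) ≤ ENNReal.ofReal M := by
    intro x₁
    have hlT : l ^ 2 / ν < T := by
      rw [hl2ν, div_lt_iff₀ hS]
      linarith [hcap]
    have hTI := hTypeI (x₀ + l • x₁) l hl hlT t ht0 hwin htT
    have hsl : l * Real.sqrt l = Real.sqrt l ^ 3 := by
      calc l * Real.sqrt l = Real.sqrt l ^ 2 * Real.sqrt l := by rw [Real.sq_sqrt hl.le]
        _ = Real.sqrt l ^ 3 := by ring
    have hs0 : 0 < Real.sqrt l := Real.sqrt_pos.2 hl
    calc eLpNorm (fun y => (l / ν) • u t (x₀ + l • y)) 2 (volume.restrict (ball x₁ 1))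
        = ‖l / ν‖ₑ * (ENNReal.ofReal ((l ^ 3)⁻¹) ^ (1 / (2 : ℝ≥0∞)).toReal *
            eLpNorm (u t) 2 (volume.restrict (ball (x₀ + l • x₁) (l * 1)))) := by
          rw [hsmul, eLpNorm_comp_add_smul_ball (u t) x₀ x₁ hl 1 (by norm_num)]
      _ ≤ ‖l / ν‖ₑ * (ENNReal.ofReal ((Real.sqrt l ^ 3)⁻¹) *
            ENNReal.ofReal (M * ν * Real.sqrt l)) := by
          rw [ofReal_inv_cube_rpow_half hl, mul_one]
          gcongr
      _ = ENNReal.ofReal M := by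
          rw [hlν, ← ENNReal.ofReal_mul (by positivity), ← ENNReal.ofReal_mul (by positivity)]
          congr 1
          rw [← hsl]
          field_simp
  -- `‖v₀‖_{L³(B₂(0))} ≤ γ` from the assumed smallness at time `t`
  have hL3 : eLpNorm (fun y => (l / ν) • u t (x₀ + l • y)) 3
      (volume.restrict (ball (0 : (EuclideanSpace ℝ (Fin 3))) 2)) ≤ ENNReal.ofReal γ := by
    have h1 : eLpNorm (u t) 3 (volume.restrict (ball x₀ (2 * l))) ≤ ENNReal.ofReal (γ * ν) :=
      (eLpNorm_mono_measure _ (Measure.restrict_mono ball_subset_closedBall le_rfl)).trans hcon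
    calc eLpNorm (fun y => (l / ν) • u t (x₀ + l • y)) 3 (volume.restrict (ball (0 : (EuclideanSpace ℝ (Fin 3))) 2))
        = ‖l / ν‖ₑ * (ENNReal.ofReal ((l ^ 3)⁻¹) ^ (1 / (3 : ℝ≥0∞)).toReal *
            eLpNorm (u t) 3 (volume.restrict (ball (x₀ + l • (0 : (EuclideanSpace ℝ (Fin 3)))) (l * 2)))) := by
          rw [hsmul, eLpNorm_comp_add_smul_ball (u t) x₀ 0 hl 2 (by norm_num)]
      _ ≤ ‖l / ν‖ₑ * (ENNReal.ofReal l⁻¹ * ENNReal.ofReal (γ * ν)) := by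
          rw [ofReal_inv_cube_rpow_third hl, smul_zero, add_zero, mul_comm l 2]
          gcongr
      _ = ENNReal.ofReal γ := by
          rw [hlν, ← ENNReal.ofReal_mul (by positivity), ← ENNReal.ofReal_mul (by positivity)]
          congr 1
          field_simp
  -- Theorem 1: the rescaled solution is bounded on `(S/2, S) × B_{1/3}(0)`
  have hbdd := hsm _ _ _ hv hE2 hL2 hL3 (S / 2) ⟨by linarith, by linarith⟩
  -- back to `u`: bounded on `(t + (T - t)/2, T) × B_{λ/3}(x₀)`
  have hpre : stAffine (l ^ 2 / ν) l t x₀ ⁻¹' (Ioo (t + (T - t) / 2) T ×ˢ ball x₀ (l / 3)) =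
      Ioo (S / 2) S ×ˢ ball (0 : (EuclideanSpace ℝ (Fin 3))) (1 / 3) := by
    rw [stAffine_preimage_cylinder hβ hl, hl2ν, sub_self, smul_zero]
    congr 1
    · congr 1
      · field_simp
        ring
      · field_simp
    · congr 1
      field_simp
  have hbdd' : eLpNorm (uncurry u) ⊤
      (volume.restrict (Ioo (t + (T - t) / 2) T ×ˢ ball x₀ (l / 3))) < ⊤ := by
    rw [← hpre, eLpNorm_top_uncurry_smul_stPull_preimage hβ hl] at hbdd
    rcases ENNReal.mul_lt_top_iff.1 hbdd with (⟨-, h⟩ | h | h)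
    · exact h
    · exact absurd h (by simp [hl0, hν0])
    · rw [h]; exact ENNReal.zero_lt_top
  -- a backward cylinder at `(T, x₀)` inside that box
  set r : ℝ := min (l / 3) (Real.sqrt ((T - t) / 2)) with hr_def
  have hr : 0 < r := lt_min (by positivity) (Real.sqrt_pos.2 (by positivity))
  have hr2 : r ^ 2 ≤ (T - t) / 2 := by
    have h1 : r ≤ Real.sqrt ((T - t) / 2) := min_le_right _ _
    have h2 : r ^ 2 ≤ Real.sqrt ((T - t) / 2) ^ 2 := pow_le_pow_left₀ hr.le h1 2
    rwa [Real.sq_sqrt (by positivity)] at h2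
  have hrT : r ^ 2 < T := by linarith
  have hsub : parabolicCylinder r ((T : ℝ), x₀) ⊆ Ioo (t + (T - t) / 2) T ×ˢ ball x₀ (l / 3) := by
    rintro ⟨s, y⟩ hz
    rw [mem_parabolicCylinder] at hz
    exact ⟨⟨by linarith [hz.1.1], hz.1.2⟩, mem_ball.2 (lt_of_lt_of_le hz.2 (min_le_left _ _))⟩
  have hlt : eLpNorm (uncurry u) ⊤ (volume.restrict (parabolicCylinder r ((T : ℝ), x₀))) < ⊤ :=
    (eLpNorm_mono_measure _ (Measure.restrict_mono hsub le_rfl)).trans_lt hbdd'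
  exact hlt.ne (hSing r hr hrT)

/-- ★★★★ **DOOR X CLOSED — `M`-ONLY EVERY-TIME `L³` CONCENTRATION AT SUP-NORM TYPE-I SINGULAR POINTS**
(`SliceL3Concentration` of ROUND 68 §M26(a)).  For every `M` there are `γ > 0` (absolute: `γ_BP³`) and
`R_m = R_m(M) > 0` such that every classical Leray–Hopf solution of the unit-viscosity unforced Navier–Stokes
system on `[0,T)` with `|u(t,x)| ≤ M/√(T − t)` and a singular point `(T, x₀)` has
`γ ≤ ∫_{B̄(x₀, R_m√(T−t))} |u(t,x)|³ dx` for all `t ∈ ((1 − S)T, T)`, `S = S(M) ∈ (0, 1/4]`.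
Proof: door X″ (`ulocMorreyBoundSupTypeI_holds`, constant `K(M)`) gives the capped Morrey-type bound with
`M₂ = √(max K 1)`; the capped local Theorem 2 above; `L³`-norm to integral by continuity of classical slices.
The constants depend on `M` ALONE (Barker–Prange 2020 Thm 2 + p. 5 have `S(M′)` with `M′ = M′(M, u₀)`).
[cite: BarkerPrange2020, Thm 2 and p. 5 (arXiv:1812.09115 pp. 2, 4–5)] -/
theorem sliceL3Concentration_holds : SliceL3Concentration := by
  intro M
  obtain ⟨K, hK⟩ := ulocMorreyBoundSupTypeI_holds M
  obtain ⟨γ, hγ, hL⟩ := l3_concentration_of_cappedMorreyTypeI_local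
  have hK1 : 0 < max K 1 := lt_max_of_lt_right one_pos
  have hM₂ : 0 < Real.sqrt (max K 1) := Real.sqrt_pos.2 hK1
  obtain ⟨S, hS, hS4, hconc⟩ := hL (Real.sqrt (max K 1)) hM₂
  refine ⟨γ ^ 3, 2 / Real.sqrt S, pow_pos hγ 3, by positivity, ?_⟩
  intro T u p hT hcl hLH hI x₀ hsing
  refine ⟨T - S * T, by nlinarith, fun t ht => ?_⟩
  have ht0 : 0 < t := by
    have h1 : T - S * T < t := ht.1
    nlinarith
  have htT : t < T := ht.2
  have hcap : T - t < S * T := by linarith [ht.1]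
  have hReg : ∀ t ∈ Ioo 0 T, ∀ x : EuclideanSpace ℝ (Fin 3), IsRegularPoint u (t, x) :=
    fun t ht x => isRegularPoint_of_classical hcl ht x
  -- door X″ in the `eLpNorm` form, capped at `r² < T`
  have hTypeI : ∀ (y : EuclideanSpace ℝ (Fin 3)) (r : ℝ), 0 < r → r ^ 2 / 1 < T → ∀ t : ℝ, 0 < t →
      T - r ^ 2 / 1 < t → t < T →
      eLpNorm (u t) 2 (volume.restrict (ball y r)) ≤
        ENNReal.ofReal (Real.sqrt (max K 1) * 1 * Real.sqrt r) := by
    intro y r hr hrT t' ht0' hwin htT'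
    rw [div_one] at hrT hwin
    rw [mul_one]
    have hb := hK T u p hT hcl hLH hI y r hr hrT t' hwin htT'
    have hut : MemLp (u t') 2 volume := hLH.memLp t' ⟨ht0'.le, htT'.le⟩
    have hint : Integrable (fun x => ‖u t' x‖ ^ 2) (volume.restrict (ball y r)) :=
      (hut.integrable_norm_pow two_ne_zero).integrableOn
    have h0 : 0 ≤ᵐ[volume.restrict (ball y r)] fun x => ‖u t' x‖ ^ 2 :=
      Eventually.of_forall fun x => by positivity
    refine eLpNorm_two_le_of_lintegral_sq_le (by positivity) ?_
    have hsq : (Real.sqrt (max K 1) * Real.sqrt r) ^ 2 = max K 1 * r := by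
      rw [mul_pow, Real.sq_sqrt hK1.le, Real.sq_sqrt hr.le]
    rw [hsq]
    calc ∫⁻ x in ball y r, ‖u t' x‖ₑ ^ 2
        = ∫⁻ x in ball y r, ENNReal.ofReal (‖u t' x‖ ^ 2) := by
          refine lintegral_congr fun x => ?_
          rw [← ofReal_norm, ENNReal.ofReal_pow (norm_nonneg _)]
      _ = ENNReal.ofReal (∫ x in ball y r, ‖u t' x‖ ^ 2) :=
          (ofReal_integral_eq_lintegral_ofReal hint h0).symm
      _ ≤ ENNReal.ofReal (max K 1 * r) := by
          refine ENNReal.ofReal_le_ofReal (hb.trans ?_)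
          exact mul_le_mul_of_nonneg_right (le_max_left _ _) hr.le
  have hSing : ∀ r : ℝ, 0 < r → r ^ 2 < T →
      eLpNorm (uncurry u) ⊤ (volume.restrict (parabolicCylinder r ((T : ℝ), x₀))) = ⊤ :=
    fun r hr _ => hsing r hr
  have hc := hconc 1 T one_pos hT (u 0) u hLH hTypeI hReg x₀ hSing t ⟨ht0, htT⟩ hcap
  rw [mul_one, one_mul] at hc
  have hrad : 2 * Real.sqrt ((T - t) / S) = 2 / Real.sqrt S * Real.sqrt (T - t) := by
    rw [Real.sqrt_div (by linarith : 0 ≤ T - t)]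
    ring
  rw [hrad] at hc
  have hslice : Continuous (u t) := by
    have hc' : ContinuousOn (uncurry u) (Ico 0 T ×ˢ univ) := hcl.smooth_velocity.continuousOn
    exact hc'.comp_continuous (continuous_const.prodMk continuous_id)
      (fun x : EuclideanSpace ℝ (Fin 3) => (⟨⟨ht0.le, htT⟩, mem_univ x⟩ : (t, x) ∈ Ico 0 T ×ˢ univ))
  exact (pow_three_lt_integral_of_ofReal_lt_eLpNorm hslice hγ.le x₀ _ hc).le

/-- ★★★★ **BARKER–PRANGE'S THEOREM 3 WITH A FIXED `δ₀ = δ₀(M, R)` ALONG ONE SEQUENCE OF TIMES — UNCONDITIONAL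
for classical Leray–Hopf solutions which are Type I in the sup-norm** (ROUND 68 §M26(f) ∘ door X): for every `M`
and `R > 0` there is `δ₀ = δ₀(M,R) > 0` — depending on `M` and `R` ALONE (ROUND 69 §M28(g) had
`δ₀(M, ‖u₀‖₂, T₀, R)`) — such that: if along SOME sequence of times `s_n → T` in `(0,T)` the vorticity directions
satisfy `|ξ(x,s_n) − ξ(y,s_n)| ≤ δ₀` for all `x, y ∈ B(x₀, R√(T − s_n))` with `|ω(·,s_n)| > d` at both points, then
`(T, x₀)` is NOT a singular point.  `δ₀` is ineffective (compactness).
[cite: BarkerPrange2020Alignment, Thm 3 (arXiv:1906.08225 p. 18); BarkerPrange2020, Thm 2;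
GigaMiura2011, Thm 1.1] -/
theorem sliceAligned_fixedDelta_not_singular_of_supTypeI_M_only (M : ℝ) {R : ℝ} (hR : 0 < R) :
    ∃ δ₀ : ℝ, 0 < δ₀ ∧
      ∀ (T : ℝ) (u : ℝ → EuclideanSpace ℝ (Fin 3) → EuclideanSpace ℝ (Fin 3))
        (p : ℝ → EuclideanSpace ℝ (Fin 3) → ℝ), 0 < T →
        IsClassicalNSSolutionOn (Ico 0 T) 1 0 u p → IsLerayHopfOn T 1 0 (u 0) u →
        (∀ t ∈ Ioo 0 T, ∀ x : EuclideanSpace ℝ (Fin 3), ‖u t x‖ ≤ M / Real.sqrt (T - t)) →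
        ∀ (x₀ : EuclideanSpace ℝ (Fin 3)) (d : ℝ) (s : ℕ → ℝ), (∀ n, s n ∈ Ioo 0 T) →
          Tendsto s atTop (𝓝 T) →
          (∀ (n : ℕ) (x y : EuclideanSpace ℝ (Fin 3)), x ∈ ball x₀ (R * Real.sqrt (T - s n)) →
            y ∈ ball x₀ (R * Real.sqrt (T - s n)) → d < ‖curl (u (s n)) x‖ → d < ‖curl (u (s n)) y‖ →
              ‖vorticityDirection (curl (u (s n))) x - vorticityDirection (curl (u (s n))) y‖ ≤ δ₀) →
          ¬ IsBackwardSingularPoint u (T, x₀) :=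
  sliceAligned_fixedDelta_not_singular_of_sliceL3Concentration sliceL3Concentration_holds M hR


end Summit.NavierStokesRegularity.NavierStokesRegularity.Theorems.StrainDoors

end
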